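import Literature.Probability.RandomPlanarGeometry.HexSAWSurfaceThirdOrderLower
import Literature.Probability.RandomPlanarGeometry.HexSAWSurfaceSecondOrderSharp
import Literature.Probability.RandomPlanarGeometry.HexSAWSurfaceWallRateEq
import HarnessLib

/-!
# Honeycomb SAW at the Duminil-Copin–Smirnov surface (brick-wall frame): DIRECT concatenation of left-proper excursions, the
# FOUR-seed renewal inequality, and the FOURTH-order term of the adsorbed-phase free energy from below —
# `β(y)² ≥ y + y/β(y)⁴ + y/β(y)⁶ + 3y/β(y)⁸ + y²/β(y)¹⁰`, hence `liminf_{y→∞} y³ (β(y)² − y − 1/y − 1/y²) ≥ 2`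

Topic `Literature/Probability/RandomPlanarGeometry` (lane «pcv-sawmu», car «WALL-FOURTH-ORDER-LOWER», a-p6 g16).  Continues
`HexSAWSurfaceThirdOrderLower.lean` (a-p6 g15: the TWO-seed renewal through the two-step junction `jcat`, the flat excursion
`Eight.fw`, `third_window_lower`) and `HexSAWSurfaceSecondOrderSharp.lean` (the upper window `β(y)² ≤ y + 1/y + 8748/y²`).

The point of this module.  The renewals of the companions glue every one-visit seed behind a two-step JUNCTION (`jcat`), which is
exact to third order but loses a factor `(β²/y)` per seed at fourth order: a dip glued behind a junction weighs `y²/β⁸` in the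
renewal equation, a dip glued DIRECTLY weighs `y/β⁶ > y²/β⁸`.  Direct gluing `ω ↦ ω · υ` (`Zd.concatWalk`) is legitimate exactly
when the seed `υ` is LEFT-PROPER (`X_i ≥ 1` for `i ≥ 1`: it touches its first column only at its start), because a wall bridge `ω`
lies in `X ≤ X_end` while the translated seed lies in `X ≥ X_end + 1` after its start.  The dip, the flat excursion and THREE of the
four one-visit seeds of length ten are left-proper; the fourth, `Ten.lw = (0,0)(1,0)(1,−1)(0,−1)(0,−2)(1,−2)(2,−2)(2,−1)(3,−1)(3,0)(4,0)`,
re-enters its first column below the surface and is glued behind a junction as before.  The resulting renewal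
`E_{j+6} ≥ y E_{j+5} + ℓ₆ y E_{j+3} + ℓ₈ y E_{j+2} + ℓ₁₀ y E_{j+1} + y² E_j` (`E_j = B^w_{2j}(y)`, `ℓ_m = lsN m` the number of left-proper
one-visit seeds of length `m`, `ℓ₆, ℓ₈ ≥ 1`, `ℓ₁₀ ≥ 3`) has characteristic root `y + 1/y + 1/y² + 2/y³ + O(y⁻⁴)`.

Sources.  E. J. Janse van Rensburg, *The Statistical Mechanics of Interacting Walks, Polygons, Animals and Vesicles* (OUP 2000), §3.1.1
(Assumptions 3.1(3), eqn (3.1): concatenation / supermultiplicativity) and §3.3.2, Lemma 3.20 (excursions).  J. M. Hammersley, G. M. Torrie,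
S. G. Whittington, J. Phys. A 15 (1982) 539, §2 (concatenation of surface bridges; locator provisional, source not held).  N. Madras, G. Slade,
*The Self-Avoiding Walk* (1993), §1.2 ((1.2.15)–(1.2.17)).  BBdGDCG, CMP 326 (2014) = arXiv:1109.0358v5, §3.1, Proposition 5 (p. 9) and the
first-order remark p. 10.  I. G. Enting, I. Jensen, LNP 775 (2009), §7.4.2, Fig. 7.10 (brickwork form).

## What is proved (namespace `…SAW.HexBW.Wall`)

* §1 `LeftProper`, `lseeds m`, `lsN m`; ★ `dcat_spec`: for a wall bridge `ω ∈ wbr n` and a LEFT-PROPER wall bridge `υ ∈ wbr m`, the direct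
  concatenation `Zd.concatWalk n ω υ` is a wall bridge of length `n + m` with `visits = visits ω + visits υ`; values on / off the row.
* §2 `Tab.walk` — explicit walks from coordinate tables with a generic components lemma; §3 the three left-proper seeds of length ten
  `Ten.aw`, `Ten.bw`, `Ten.cw` and the junction-bound seed `Ten.lw` (facts by `decide`, lengths kept symbolic in memberships);
  `leftProper_dw`, `leftProper_fw`; `one_le_lsN_six`, `one_le_lsN_eight`, `three_le_lsN_ten`.
* §4 ★★ **`WB_four_seed_rec : y B^w_{n+10} + ℓ₆ y B^w_{n+6} + ℓ₈ y B^w_{n+4} + ℓ₁₀ y B^w_{n+2} + y² B^w_n ≤ B^w_{n+12}`** — FIVE pairwise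
  disjoint injections (junction; direct dip; direct flat; direct left-proper ten; junction + `Ten.lw`), separated by the height at the
  times `n+10`, `n+6`, `n+4` (row versus inside a one-visit seed at a positive even seed time) and, for the two length-ten families, by
  the abscissa three steps into the seed (`≥ X + 1` for a left-proper seed, `= X` for `Ten.lw`).
* §5 ★ `le_sq_wallRate_of_four_seed_subsolution`, ★★ `four_seed_le_wallRate_pow_twelve :
  y β¹⁰ + ℓ₆ y β⁶ + ℓ₈ y β⁴ + ℓ₁₀ y β² + y² ≤ β¹²`, ★★ `add_four_seed_div_le_sq_wallRate : y + y/β⁴ + y/β⁶ + 3y/β⁸ + y²/β¹⁰ ≤ β²`.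
* §6 ★★★ **`fourth_window_lower (0 < y) (0 ≤ C) (β² ≤ y + 1/y + C/y²) :
  y + 1/y + 1/y² + 2/y³ − (3+2C)/y⁴ − (17+3C)/y⁵ − 17C/y⁶ ≤ β(y)²`**; with the companion's window (`C = 8748`, `y ≥ 1`):
  ★★★ `fourth_lower_sharp (1 ≤ y) : y + 1/y + 1/y² + 2/y³ − 192476/y⁴ ≤ β(y)²`, `two_sub_div_le_cube_mul (1 ≤ y) :
  2 − 192476/y ≤ y³ (β² − y − 1/y − 1/y²)`, `eventually_le_cube_mul_wallRate_sq_sub (a < 2) : ∀ᶠ y, a ≤ y³ (β² − y − 1/y − 1/y²)`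
  (so `liminf ≥ 2`), and the same for BBdGDCG's `μ(y) = HV.surfaceMu y` (`HV.two_sub_div_le_cube_mul_surfaceMu`, …).

HONEST LABEL (author's proposal).  §1, §4: LANE LEMMAS S — the direct-concatenation device for left-proper excursions and the five-image
renewal are new in the lane (the companions glue through junctions only).  §5–§6: LANE THEOREM S; the fourth coefficient `≥ 2` is NEW IN
WRITING (modest) in the same sense as the companions (print: first order only, BBdGDCG p. 10).  CONJECTURE (not claimed, census evidence
in the car's INBOX line): `β(y)² = y + 1/y + 1/y² + 2/y³ + 4/y⁴ + 6/y⁵ + O(y⁻⁶)` — the exact deficit census of wall bridges to deficit six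
matches the free word count in the one-visit seeds, whose cluster expansion has these coefficients; the matching UPPER bound at fourth
order (four-step-extendable arches) is not attempted here.  NOT CLAIMED: `ℓ₁₀ = 3`, `wbrN 10 1 = 4`, anything for the armchair wall.

EDITION NOTE (ed.2): the Madras–Slade locator of `dcat_injOn` corrected (ref FO-1); the left hook is `Ten.lw` (tables `lX`, `lY`) so that
no reader of `namespace …Wall` meets a second `uw` (the tree's `Wall.uw` of `HexSAWSurfaceWallRateEq`; lit-1 hygiene note).
-/

noncomputable section

open Finset Filter Function
open Literature.Probability.LatticeModels Literature.Probability.Percolation SimpleGraph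
open _root_.Topology

namespace Literature.Probability.RandomPlanarGeometry.SAW.HexBW.Wall

variable {y : ℝ} {n m : ℕ} {ω υ : ℕ → Site 2}

/-! ### §1  Left-proper wall bridges and direct concatenation -/

/-- **Left-proper** walks of length `m`: `X_i ≥ 1` for `1 ≤ i ≤ m` (the walk touches its first column only at its start).
[cite: HammersleyTorrieWhittington1982, §2 (concatenation of surface bridges)] -/
def LeftProper (m : ℕ) (υ : ℕ → Site 2) : Prop := ∀ i, 1 ≤ i → i ≤ m → 1 ≤ υ i 0

open Classical in
/-- **Left-proper one-visit seeds** of length `m`. [cite: JansevanRensburg2000, §3.3.2, Lemma 3.20 (excursions)] -/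
def lseeds (m : ℕ) : Finset (ℕ → Site 2) := (seeds m).filter (LeftProper m)

/-- **`ℓ_m := #(lseeds m)`**, the number of left-proper one-visit seeds of length `m`. [cite: JansevanRensburg2000, §3.3.2, Lemma 3.20 (excursions)] -/
def lsN (m : ℕ) : ℕ := #(lseeds m)

open Classical in
/-- Membership in `lseeds`. [cite: JansevanRensburg2000, §3.3.2, Lemma 3.20 (excursions)] -/
theorem mem_lseeds : υ ∈ lseeds m ↔ υ ∈ wbr m ∧ visits m υ = 1 ∧ LeftProper m υ := by
  rw [lseeds, Finset.mem_filter, seeds, Finset.mem_filter, and_assoc]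

/-- ★ **DIRECT CONCATENATION WITH A LEFT-PROPER WALL BRIDGE is a wall bridge with `visits = v₁ + v₂`**: `ω` lies in `X ≤ X^ω_n`, the
translated `υ` in `X ≥ X^ω_n + 1` after its start, so the two pieces are disjoint; the gluing site `ω n` is a surface site (even parity),
so the translate of `υ` is again a brick-wall walk. [cite: HammersleyTorrieWhittington1982, §2 (concatenation of surface bridges)] [cite: MadrasSlade1993, §1.2, (1.2.15)] -/
theorem dcat_spec (hω : ω ∈ wbr n) (hυ : υ ∈ wbr m) (hl : LeftProper m υ) :
    Zd.concatWalk n ω υ ∈ wbr (n + m) ∧ visits (n + m) (Zd.concatWalk n ω υ) = visits n ω + visits m υ := by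
  obtain ⟨hυa, hυwb⟩ := mem_wbr.1 hυ
  obtain ⟨hυh, hm2, hυend⟩ := mem_archs.1 hυa
  obtain ⟨hυs, hυhp⟩ := mem_hpw.1 hυh
  obtain ⟨hυ0, -, hυbw, -⟩ := mem_saws_iff.1 hυs
  have hυX0 : υ 0 0 = 0 := by rw [hυ0]; rfl
  have hυX : ∀ j ≤ m, 0 ≤ υ j 0 ∧ υ j 0 ≤ υ m 0 := fun j hj => by
    have := hυwb j hj; rw [hυX0] at this; exact this
  obtain ⟨hωa, hwb⟩ := mem_wbr.1 hω
  obtain ⟨hωh, hn2, hend0⟩ := mem_archs.1 hωa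
  obtain ⟨hωs, hhp⟩ := mem_hpw.1 hωh
  obtain ⟨h0, -, hbw, -⟩ := mem_saws_iff.1 hωs
  have hpar : (ω n 0 + ω n 1) % 2 = 0 := by
    have := parity_apply hωs le_rfl; rw [hend0] at this ⊢; omega
  have hv1 : ∀ i ≤ n, Zd.concatWalk n ω υ i = ω i := fun i hi => Zd.concatWalk_apply_of_le _ _ hi
  have hv2 : ∀ j, Zd.concatWalk n ω υ (n + j) = ω n + υ j := fun j => Zd.concatWalk_apply_add _ _ hυ0 j
  have hmem : Zd.concatWalk n ω υ ∈ saws (n + m) := by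
    refine mem_saws.2 ⟨Zd.concatWalk_mem_saws (saws_subset _ hωs) (saws_subset _ hυs) ?_, isBW_concatWalk hbw hυbw hυ0 hpar⟩
    intro i hi j hj1 hj e
    have e0 := congrFun e 0
    rw [Pi.add_apply] at e0
    have := (hwb i hi).2
    have := hl j hj1 hj
    omega
  refine ⟨mem_wbr.2 ⟨mem_archs.2 ⟨mem_hpw.2 ⟨hmem, fun i hi => ?_⟩, ⟨by omega, ?_⟩⟩, fun i hi => ?_⟩, ?_⟩
  · rcases le_or_gt i n with h | h
    · rw [hv1 i h]; exact hhp i h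
    · rw [show i = n + (i - n) by omega, hv2, Pi.add_apply, hend0, zero_add]
      exact hυhp _ (by omega)
  · rw [hv2, Pi.add_apply, hend0, hυend, add_zero]
  · have hlast : Zd.concatWalk n ω υ (n + m) 0 = ω n 0 + υ m 0 := by rw [hv2, Pi.add_apply]
    have hfirst : Zd.concatWalk n ω υ 0 0 = ω 0 0 := by rw [hv1 0 (Nat.zero_le _)]
    rw [hlast, hfirst]
    rcases le_or_gt i n with h | h
    · rw [hv1 i h]
      have := hwb i h
      have := (hυX m le_rfl).1
      constructor <;> linarith
    · rw [show i = n + (i - n) by omega, hv2, Pi.add_apply]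
      have := hυX (i - n) (by omega)
      have := hwb n le_rfl
      constructor <;> linarith
  · rw [visits_add (a := n) (b := m) (ξ := υ) hn2 fun j _ _ => by rw [hv2, Pi.add_apply, hend0, zero_add],
      visits_congr (ξ := ω) fun i _ hi => by rw [hv1 i hi]]

/-- At the gluing time a direct concatenation is ON the row. [cite: HammersleyTorrieWhittington1982, §2 (concatenation of surface bridges)] -/
theorem dcat_apply_self_one (hω : ω ∈ wbr n) (υ : ℕ → Site 2) : Zd.concatWalk n ω υ n 1 = 0 := by
  rw [Zd.concatWalk_apply_of_le _ _ le_rfl]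
  exact (mem_archs.1 (mem_wbr.1 hω).1).2.2

/-- Inside a directly glued one-visit seed, at a positive even seed time `t < m`, the concatenation is OFF the row.
[cite: HammersleyTorrieWhittington1982, §2 (concatenation of surface bridges); BeatonBousquetMelouDeGierDuminilCopinGuttmann2014, §3.1 (arXiv v5 p. 8: surface contacts)] -/
theorem dcat_seed_apply_one_at (hω : ω ∈ wbr n) (hυ : υ ∈ wbr m) (hv : visits m υ = 1) {t : ℕ}
    (ht : t % 2 = 0) (h0t : 0 < t) (htm : t < m) : Zd.concatWalk n ω υ (n + t) 1 ≠ 0 := by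
  have hυ0 : υ 0 = 0 := (mem_saws_iff.1 (hpw_subset (archs_subset (wbr_subset hυ)))).1
  rw [Zd.concatWalk_apply_add _ _ hυ0 t, Pi.add_apply, (mem_archs.1 (mem_wbr.1 hω).1).2.2, zero_add]
  exact apply_ne_zero_of_visits_eq_one hυ hv ht h0t htm

/-- Three steps into a directly glued LEFT-PROPER seed (`3 ≤ m`) the abscissa exceeds the gluing abscissa.
[cite: HammersleyTorrieWhittington1982, §2 (concatenation of surface bridges)] -/
theorem dcat_apply_add_three_zero (ω : ℕ → Site 2) (hυ : υ ∈ wbr m) (hl : LeftProper m υ) (hm : 3 ≤ m) :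
    Zd.concatWalk n ω υ n 0 + 1 ≤ Zd.concatWalk n ω υ (n + 3) 0 := by
  have hυ0 : υ 0 = 0 := (mem_saws_iff.1 (hpw_subset (archs_subset (wbr_subset hυ)))).1
  rw [Zd.concatWalk_apply_add _ _ hυ0 3, Pi.add_apply, Zd.concatWalk_apply_of_le _ _ le_rfl]
  have := hl 3 (by norm_num) hm
  linarith

/-- Direct concatenation at a fixed gluing time is injective in the pair (wall bridge, seed).
[cite: MadrasSlade1993, §1.2, (1.2.15) (b_M b_N ≤ b_{M+N}); §3.1, proof of Corollary 3.1.6 (p. 61: "the sequence of bridges uniquely determines the original half-space walk")] -/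
theorem dcat_injOn (n m : ℕ) (P : Finset ((ℕ → Site 2) × (ℕ → Site 2))) (hP : P ⊆ wbr n ×ˢ wbr m) :
    Set.InjOn (fun q : (ℕ → Site 2) × (ℕ → Site 2) => Zd.concatWalk n q.1 q.2) ↑P := by
  rintro ⟨ω₁, υ₁⟩ hq ⟨ω₂, υ₂⟩ hq' h
  have hq0 := Finset.mem_product.1 (hP (Finset.mem_coe.1 hq))
  have hq0' := Finset.mem_product.1 (hP (Finset.mem_coe.1 hq'))
  have hωs := hpw_subset (archs_subset (wbr_subset hq0.1))
  have hω's := hpw_subset (archs_subset (wbr_subset hq0'.1))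
  have hυs := hpw_subset (archs_subset (wbr_subset hq0.2))
  have hυ's := hpw_subset (archs_subset (wbr_subset hq0'.2))
  obtain ⟨h1, h2⟩ := Zd.concatWalk_injective_pieces (saws_subset _ hωs) (saws_subset _ hυs)
    (saws_subset _ hω's) (saws_subset _ hυ's) h
  simp only [Prod.mk.injEq]
  exact ⟨h1, h2⟩

/-! ### §2  Explicit walks from coordinate tables -/

namespace Tab

/-- The walk `i ↦ (X (min i L), Y (min i L))` read off two coordinate tables (frozen after time `L`).
[cite: EntingJensen2009, §7.4.2, Fig. 7.10 (brickwork form of the honeycomb lattice)] -/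
def walk (L : ℕ) (X Y : ℕ → ℤ) (i : ℕ) : Site 2 := Arm.pt (X (min i L)) (Y (min i L))

/-- The decidable coordinate facts making `walk L X Y` a left-proper wall bridge of (even) length `L`.
[cite: EntingJensen2009, §7.4.2, Fig. 7.10; MadrasSlade1993, §1.2, Definition 1.2.1 (bridges)] -/
def Facts (L : ℕ) (X Y : ℕ → ℤ) : Prop :=
  (∀ i < L, Eight.adjE (X i) (Y i) (X (i + 1)) (Y (i + 1)) = true) ∧
    (∀ i ≤ L, ∀ j ≤ L, X i = X j → Y i = Y j → i = j) ∧ (∀ i ≤ L, Y i ≤ 0) ∧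
    (∀ i ≤ L, X 0 ≤ X i ∧ X i ≤ X L) ∧ X 0 = 0 ∧ Y 0 = 0 ∧ Y L = 0 ∧ L % 2 = 0 ∧ (∀ i ≤ L, 1 ≤ i → 1 ≤ X i)

variable {L : ℕ} {X Y : ℕ → ℤ}

/-- Values of a table walk up to time `L`. [cite: EntingJensen2009, §7.4.2, Fig. 7.10] -/
theorem walk_apply_of_le {i : ℕ} (hi : i ≤ L) : walk L X Y i = Arm.pt (X i) (Y i) := by
  simp only [walk, min_eq_left hi]

/-- Membership components of a table walk (`∀`/`∧`/`=` form) and left-properness.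
[cite: MadrasSlade1993, §1.2, Definition 1.2.1 (bridges); EntingJensen2009, §7.4.2, Fig. 7.10] -/
theorem walk_components (h : Facts L X Y) :
    walk L X Y 0 = 0 ∧ (∀ i, L ≤ i → walk L X Y i = walk L X Y L) ∧ IsBW L (walk L X Y) ∧
      Set.InjOn (walk L X Y) {i | i ≤ L} ∧ InHP L (walk L X Y) ∧ IsArch L (walk L X Y) ∧ IsWB L (walk L X Y) ∧
      LeftProper L (walk L X Y) := by
  obtain ⟨hadj, hinj, hY, hmono, hX0, hY0, hYL, hL2, hleft⟩ := h
  refine ⟨?_, fun i hi => by simp only [walk, min_eq_right hi, min_self], fun i hi => ?_, fun i hi j hj hij => ?_, fun i hi => ?_,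
    ⟨hL2, ?_⟩, fun i hi => ?_, fun i h1 hi => ?_⟩
  · rw [site_two_eq_iff]; simp only [walk, Nat.zero_min, Arm.pt_apply_zero, Arm.pt_apply_one, hX0, hY0]; exact ⟨rfl, rfl⟩
  · simp only [walk, min_eq_left hi.le, min_eq_left (Nat.succ_le_of_lt hi)]; exact Eight.adj_of_adjE (hadj i hi)
  · simp only [Set.mem_setOf_eq] at hi hj
    have h0 := congrFun hij 0
    have h1 := congrFun hij 1
    simp only [walk, Arm.pt_apply_zero, Arm.pt_apply_one, min_eq_left hi, min_eq_left hj] at h0 h1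
    exact hinj i hi j hj h0 h1
  · simp only [walk, Arm.pt_apply_one, min_eq_left hi]; exact hY i hi
  · simp only [walk, Arm.pt_apply_one, min_self]; exact hYL
  · simp only [walk, Arm.pt_apply_zero, Nat.zero_min, min_self, min_eq_left hi]; exact hmono i hi
  · simp only [walk, Arm.pt_apply_zero, min_eq_left hi]; exact hleft i hi h1

/-- A table walk satisfying the facts is a left-proper wall bridge (length symbolic). [cite: MadrasSlade1993, §1.2, Definition 1.2.1 (bridges); HammersleyTorrieWhittington1982, §2] -/
theorem walk_mem_wbr (h : Facts L X Y) : walk L X Y ∈ wbr L ∧ LeftProper L (walk L X Y) := by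
  obtain ⟨h0, hfr, hbw, hinj, hH, harch, hwb, hl⟩ := walk_components h
  refine ⟨?_, hl⟩
  rw [mem_wbr, mem_archs, mem_hpw, mem_saws_iff]
  exact ⟨⟨⟨⟨h0, hfr, hbw, hinj⟩, hH⟩, harch⟩, hwb⟩

end Tab

/-! ### §3  The seeds: the dip, the flat excursion, the four one-visit seeds of length ten -/

namespace Ten

/-- `X`-table of the long flat excursion `(0,0)(1,0)(1,−1)(2,−1)…(7,−1)(7,0)(8,0)`. [cite: EntingJensen2009, §7.4.2, Fig. 7.10] -/
def aX : ℕ → ℤ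
  | 0 => 0 | 1 => 1 | 2 => 1 | 3 => 2 | 4 => 3 | 5 => 4 | 6 => 5 | 7 => 6 | 8 => 7 | 9 => 7 | _ => 8

/-- `Y`-table of the long flat excursion. [cite: EntingJensen2009, §7.4.2, Fig. 7.10] -/
def aY : ℕ → ℤ
  | 2 => -1 | 3 => -1 | 4 => -1 | 5 => -1 | 6 => -1 | 7 => -1 | 8 => -1 | _ => 0

/-- `X`-table of the terrace excursion `(0,0)(1,0)(1,−1)(2,−1)(2,−2)(3,−2)(4,−2)(4,−1)(5,−1)(5,0)(6,0)`. [cite: EntingJensen2009, §7.4.2, Fig. 7.10] -/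
def bX : ℕ → ℤ
  | 0 => 0 | 1 => 1 | 2 => 1 | 3 => 2 | 4 => 2 | 5 => 3 | 6 => 4 | 7 => 4 | 8 => 5 | 9 => 5 | _ => 6

/-- `Y`-table of the terrace excursion. [cite: EntingJensen2009, §7.4.2, Fig. 7.10] -/
def bY : ℕ → ℤ
  | 2 => -1 | 3 => -1 | 4 => -2 | 5 => -2 | 6 => -2 | 7 => -1 | 8 => -1 | _ => 0

/-- `X`-table of the right hook `(0,0)(1,0)(1,−1)(2,−1)(2,−2)(3,−2)(4,−2)(4,−1)(3,−1)(3,0)(4,0)`. [cite: EntingJensen2009, §7.4.2, Fig. 7.10] -/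
def cX : ℕ → ℤ
  | 0 => 0 | 1 => 1 | 2 => 1 | 3 => 2 | 4 => 2 | 5 => 3 | 6 => 4 | 7 => 4 | 8 => 3 | 9 => 3 | _ => 4

/-- `Y`-table of the right hook. [cite: EntingJensen2009, §7.4.2, Fig. 7.10] -/
def cY : ℕ → ℤ
  | 2 => -1 | 3 => -1 | 4 => -2 | 5 => -2 | 6 => -2 | 7 => -1 | 8 => -1 | _ => 0

/-- `X`-table of the left hook `(0,0)(1,0)(1,−1)(0,−1)(0,−2)(1,−2)(2,−2)(2,−1)(3,−1)(3,0)(4,0)` (NOT left-proper).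
[cite: EntingJensen2009, §7.4.2, Fig. 7.10] -/
def lX : ℕ → ℤ
  | 0 => 0 | 1 => 1 | 2 => 1 | 3 => 0 | 4 => 0 | 5 => 1 | 6 => 2 | 7 => 2 | 8 => 3 | 9 => 3 | _ => 4

/-- `Y`-table of the left hook. [cite: EntingJensen2009, §7.4.2, Fig. 7.10] -/
def lY : ℕ → ℤ
  | 2 => -1 | 3 => -1 | 4 => -2 | 5 => -2 | 6 => -2 | 7 => -1 | 8 => -1 | _ => 0

/-- The long flat excursion of length ten. [cite: EntingJensen2009, §7.4.2, Fig. 7.10] -/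
def aw : ℕ → Site 2 := Tab.walk 10 aX aY
/-- The terrace excursion of length ten. [cite: EntingJensen2009, §7.4.2, Fig. 7.10] -/
def bw : ℕ → Site 2 := Tab.walk 10 bX bY
/-- The right hook of length ten. [cite: EntingJensen2009, §7.4.2, Fig. 7.10] -/
def cw : ℕ → Site 2 := Tab.walk 10 cX cY
/-- The left hook of length ten (one visit, a wall bridge, not left-proper). [cite: EntingJensen2009, §7.4.2, Fig. 7.10] -/
def lw : ℕ → Site 2 := Tab.walk 10 lX lY

/-- Coordinate facts of the long flat excursion, by `decide`. [cite: EntingJensen2009, §7.4.2, Fig. 7.10] -/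
theorem a_facts : Tab.Facts 10 aX aY := by unfold Tab.Facts; decide
/-- Coordinate facts of the terrace excursion, by `decide`. [cite: EntingJensen2009, §7.4.2, Fig. 7.10] -/
theorem b_facts : Tab.Facts 10 bX bY := by unfold Tab.Facts; decide
/-- Coordinate facts of the right hook, by `decide`. [cite: EntingJensen2009, §7.4.2, Fig. 7.10] -/
theorem c_facts : Tab.Facts 10 cX cY := by unfold Tab.Facts; decide

/-- Coordinate facts of the left hook (all but left-properness), by `decide`. [cite: EntingJensen2009, §7.4.2, Fig. 7.10] -/
theorem l_facts : (∀ i < 10, Eight.adjE (lX i) (lY i) (lX (i + 1)) (lY (i + 1)) = true) ∧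
    (∀ i ≤ 10, ∀ j ≤ 10, lX i = lX j → lY i = lY j → i = j) ∧ (∀ i ≤ 10, lY i ≤ 0) ∧
    (∀ i ≤ 10, lX 0 ≤ lX i ∧ lX i ≤ lX 10) ∧ lX 0 = 0 ∧ lY 0 = 0 ∧ lY 10 = 0 := by decide

/-- One surface visit each (kernel evaluation). [cite: BeatonBousquetMelouDeGierDuminilCopinGuttmann2014, §3.1 (arXiv v5 p. 8: "the number of contacts with the surface")] -/
theorem visits_ten : visits 10 aw = 1 ∧ visits 10 bw = 1 ∧ visits 10 cw = 1 ∧ visits 10 lw = 1 := by decide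

/-- The three left-proper seeds are pairwise distinct (abscissa at time `8`: `7`, `5`, `3`). [cite: EntingJensen2009, §7.4.2, Fig. 7.10] -/
theorem aw_ne_bw_ne_cw : aw ≠ bw ∧ aw ≠ cw ∧ bw ≠ cw := by
  refine ⟨fun h => ?_, fun h => ?_, fun h => ?_⟩ <;>
  · have := congrFun (congrFun h 8) 0
    revert this
    decide

/-- Membership components of the left hook. [cite: MadrasSlade1993, §1.2, Definition 1.2.1 (bridges); EntingJensen2009, §7.4.2, Fig. 7.10] -/
theorem lw_components : lw 0 = 0 ∧ (∀ i, 10 ≤ i → lw i = lw 10) ∧ IsBW 10 lw ∧ Set.InjOn lw {i | i ≤ 10} ∧ InHP 10 lw ∧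
    IsArch 10 lw ∧ IsWB 10 lw := by
  obtain ⟨hadj, hinj, hY, hmono, hX0, hY0, hY8⟩ := l_facts
  refine ⟨?_, fun i hi => by simp only [lw, Tab.walk, min_eq_right hi, min_self], fun i hi => ?_, fun i hi j hj hij => ?_,
    fun i hi => ?_, ⟨by norm_num, ?_⟩, fun i hi => ?_⟩
  · rw [site_two_eq_iff]; simp only [lw, Tab.walk, Nat.zero_min, Arm.pt_apply_zero, Arm.pt_apply_one, hX0, hY0]; exact ⟨rfl, rfl⟩
  · simp only [lw, Tab.walk, min_eq_left hi.le, min_eq_left (Nat.succ_le_of_lt hi)]; exact Eight.adj_of_adjE (hadj i hi)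
  · simp only [Set.mem_setOf_eq] at hi hj
    have h0 := congrFun hij 0
    have h1 := congrFun hij 1
    simp only [lw, Tab.walk, Arm.pt_apply_zero, Arm.pt_apply_one, min_eq_left hi, min_eq_left hj] at h0 h1
    exact hinj i hi j hj h0 h1
  · simp only [lw, Tab.walk, Arm.pt_apply_one, min_eq_left hi]; exact hY i hi
  · simp only [lw, Tab.walk, Arm.pt_apply_one, min_self]; exact hY8
  · simp only [lw, Tab.walk, Arm.pt_apply_zero, Nat.zero_min, min_self, min_eq_left hi]; exact hmono i hi

/-- The left hook is a wall bridge with one visit (length symbolic). [cite: MadrasSlade1993, §1.2, Definition 1.2.1 (bridges); HammersleyTorrieWhittington1982, §2] -/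
theorem lw_mem_wbr : ∀ m', m' = 10 → lw ∈ wbr m' ∧ visits m' lw = 1 := by
  intro m' hm
  obtain ⟨h0, hfr, hbw, hinj, hH, harch, hwb⟩ := lw_components
  subst hm
  refine ⟨?_, visits_ten.2.2.2⟩
  rw [mem_wbr, mem_archs, mem_hpw, mem_saws_iff]
  exact ⟨⟨⟨⟨h0, hfr, hbw, hinj⟩, hH⟩, harch⟩, hwb⟩

/-- Abscissae of the left hook at seed times `0` and `3` coincide (it re-enters its first column). [cite: EntingJensen2009, §7.4.2, Fig. 7.10] -/
theorem lw_three_zero : lw 3 0 = 0 ∧ lw 0 0 = 0 := by decide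

end Ten

/-- The dip `Six.dw` is left-proper. [cite: EntingJensen2009, §7.4.2, Fig. 7.10] -/
theorem leftProper_dw : LeftProper 6 Six.dw := by
  intro i h1 hi
  simp only [Six.dw, Arm.pt_apply_zero, min_eq_left hi]
  revert i
  decide

/-- The flat excursion `Eight.fw` is left-proper. [cite: EntingJensen2009, §7.4.2, Fig. 7.10] -/
theorem leftProper_fw : LeftProper 8 Eight.fw := by
  intro i h1 hi
  simp only [Eight.fw, Arm.pt_apply_zero, min_eq_left hi]
  revert i
  decide

open Classical Six in
/-- **`1 ≤ ℓ₆`**: the dip is a left-proper one-visit seed of length six. [cite: JansevanRensburg2000, §3.3.2, Lemma 3.20; EntingJensen2009, §7.4.2, Fig. 7.10] -/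
theorem one_le_lsN_six : 1 ≤ lsN 6 := by
  have key : ∀ m', m' = 6 → 1 ≤ #(lseeds m') := by
    intro m' hm
    obtain ⟨h0, hfr, hbw, hinj, hH, harch, hwb⟩ := dw_components
    have h1 : dw ∈ wbr m' := by
      rw [mem_wbr, mem_archs, mem_hpw, mem_saws_iff]
      subst hm
      exact ⟨⟨⟨⟨h0, hfr, hbw, hinj⟩, hH⟩, harch⟩, hwb⟩
    have h2 : visits m' dw = 1 := by rw [hm]; exact visits_sw_dw.2
    have h3 : LeftProper m' dw := by rw [hm]; exact leftProper_dw
    exact Finset.card_pos.2 ⟨_, mem_lseeds.2 ⟨h1, h2, h3⟩⟩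
  exact key 6 rfl

open Classical in
/-- **`1 ≤ ℓ₈`**: the flat excursion is a left-proper one-visit seed of length eight. [cite: JansevanRensburg2000, §3.3.2, Lemma 3.20; EntingJensen2009, §7.4.2, Fig. 7.10] -/
theorem one_le_lsN_eight : 1 ≤ lsN 8 := by
  have key : ∀ m', m' = 8 → 1 ≤ #(lseeds m') := by
    intro m' hm
    obtain ⟨h0, hfr, hbw, hinj, hH, harch, hwb⟩ := Eight.fw_components
    have h1 : Eight.fw ∈ wbr m' := by
      rw [mem_wbr, mem_archs, mem_hpw, mem_saws_iff]
      subst hm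
      exact ⟨⟨⟨⟨h0, hfr, hbw, hinj⟩, hH⟩, harch⟩, hwb⟩
    have h2 : visits m' Eight.fw = 1 := by rw [hm]; exact Eight.visits_fw
    have h3 : LeftProper m' Eight.fw := by rw [hm]; exact leftProper_fw
    exact Finset.card_pos.2 ⟨_, mem_lseeds.2 ⟨h1, h2, h3⟩⟩
  exact key 8 rfl

open Classical Ten in
/-- **`3 ≤ ℓ₁₀`**: the long flat excursion, the terrace and the right hook are three distinct left-proper one-visit seeds of
length ten. [cite: JansevanRensburg2000, §3.3.2, Lemma 3.20; EntingJensen2009, §7.4.2, Fig. 7.10] -/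
theorem three_le_lsN_ten : 3 ≤ lsN 10 := by
  have key : ∀ m', m' = 10 → 3 ≤ #(lseeds m') := by
    intro m' hm
    have mem : ∀ {w : ℕ → Site 2}, (w 0 = 0 ∧ (∀ i, 10 ≤ i → w i = w 10) ∧ IsBW 10 w ∧ Set.InjOn w {i | i ≤ 10} ∧ InHP 10 w ∧
        IsArch 10 w ∧ IsWB 10 w ∧ LeftProper 10 w) → visits 10 w = 1 → w ∈ lseeds m' := by
      intro w hw hv
      obtain ⟨h0, hfr, hbw, hinj, hH, harch, hwb, hl⟩ := hw
      have h1 : w ∈ wbr m' := by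
        rw [mem_wbr, mem_archs, mem_hpw, mem_saws_iff]
        subst hm
        exact ⟨⟨⟨⟨h0, hfr, hbw, hinj⟩, hH⟩, harch⟩, hwb⟩
      have h2 : visits m' w = 1 := by rw [hm]; exact hv
      have h3 : LeftProper m' w := by rw [hm]; exact hl
      exact mem_lseeds.2 ⟨h1, h2, h3⟩
    have ha : aw ∈ lseeds m' := mem (Tab.walk_components a_facts) visits_ten.1
    have hb : bw ∈ lseeds m' := mem (Tab.walk_components b_facts) visits_ten.2.1
    have hc : cw ∈ lseeds m' := mem (Tab.walk_components c_facts) visits_ten.2.2.1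
    obtain ⟨hab, hac, hbc⟩ := aw_ne_bw_ne_cw
    have hsub : ({aw, bw, cw} : Finset (ℕ → Site 2)) ⊆ lseeds m' := by
      intro w hw
      simp only [Finset.mem_insert, Finset.mem_singleton] at hw
      rcases hw with rfl | rfl | rfl
      · exact ha
      · exact hb
      · exact hc
    have hcard : #({aw, bw, cw} : Finset (ℕ → Site 2)) = 3 := by
      rw [Finset.card_insert_of_notMem, Finset.card_insert_of_notMem, Finset.card_singleton]
      · simpa using hbc
      · simp [hab, hac]
    exact hcard ▸ Finset.card_le_card hsub
  exact key 10 rfl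

/-! ### §4  THE FOUR-SEED RENEWAL: five pairwise disjoint injections -/

set_option maxHeartbeats 400000 in
open Classical in
/-- ★★ **THE FOUR-SEED RECURSION `y B^w_{n+10} + ℓ₆ y B^w_{n+6} + ℓ₈ y B^w_{n+4} + ℓ₁₀ y B^w_{n+2} + y² B^w_n ≤ B^w_{n+12}`** (`y ≥ 0`):
extend a wall bridge of length `n+10` by the junction (U: two steps, one visit), or one of length `n+6` DIRECTLY by a left-proper
dip (one visit), or one of length `n+4` directly by a left-proper flat excursion, or one of length `n+2` directly by a left-proper
seed of length ten, or one of length `n` by the junction and the left hook `Ten.lw` (two visits).  The five images are pairwise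
disjoint: U is on the row at time `n+10`, where the four others sit inside a one-visit seed at a positive even seed time; the dip
family is on the row at time `n+6`, where the longer seeds are inside; the flat family is on the row at time `n+4`; and the two
length-ten families are separated three steps into the seed (abscissa `≥ X_{n+2} + 1` for a left-proper seed, `= X_{n+2}` for the
left hook). [cite: HammersleyTorrieWhittington1982, §2 (concatenation of surface bridges)] [cite: JansevanRensburg2000, §3.1.1, Assumptions 3.1(3), eqn (3.1)] [cite: MadrasSlade1993, §1.2, (1.2.15)] -/
theorem WB_four_seed_rec (n : ℕ) (hy : 0 ≤ y) :
    y * WB (n + 10) y + (lsN 6 : ℝ) * y * WB (n + 6) y + (lsN 8 : ℝ) * y * WB (n + 4) y + (lsN 10 : ℝ) * y * WB (n + 2) y +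
        y ^ 2 * WB n y ≤ WB (n + 12) y := by
  -- keep the three seed lengths symbolic (closed `Finset` literals must never meet the unifier)
  suffices h : ∀ a b c : ℕ, a = 6 → b = 8 → c = 10 →
      y * WB (n + 10) y + (lsN a : ℝ) * y * WB (n + 6) y + (lsN b : ℝ) * y * WB (n + 4) y + (lsN c : ℝ) * y * WB (n + 2) y +
        y ^ 2 * WB n y ≤ WB (n + 12) y from h 6 8 10 rfl rfl rfl
  intro a b c ha hb hc
  set triv : ℕ → Site 2 := Zd.straightWalk 2 0 with htriv
  have htm : triv ∈ wbr 0 := straightWalk_zero_mem_wbr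
  obtain ⟨hu, huv⟩ := Ten.lw_mem_wbr c hc
  -- the five maps and their domains
  set fU : (ℕ → Site 2) → (ℕ → Site 2) := fun ω => jcat (n + 10) ω triv with hfU
  set fD : ℕ → (ℕ → Site 2) × (ℕ → Site 2) → (ℕ → Site 2) := fun k q => Zd.concatWalk k q.1 q.2 with hfD
  set fJ : (ℕ → Site 2) → (ℕ → Site 2) := fun ω => jcat n ω Ten.lw with hfJ
  set H₆ := (wbr (n + 6)) ×ˢ lseeds a with hH₆
  set H₈ := (wbr (n + 4)) ×ˢ lseeds b with hH₈
  set H₁₀ := (wbr (n + 2)) ×ˢ lseeds c with hH₁₀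
  set N := n + 12 with hN
  -- generic facts about the direct families
  have Dfacts : ∀ {k m' : ℕ} (hkm : k + m' = N) {q : (ℕ → Site 2) × (ℕ → Site 2)}, q ∈ (wbr k) ×ˢ lseeds m' →
      fD k q ∈ wbr N ∧ visits N (fD k q) = visits k q.1 + 1 ∧ fD k q k 1 = 0 ∧
        (∀ t, t % 2 = 0 → 0 < t → t < m' → fD k q (k + t) 1 ≠ 0) ∧ (3 ≤ m' → fD k q k 0 + 1 ≤ fD k q (k + 3) 0) := by
    intro k m' hkm q hq
    obtain ⟨hq1, hq2⟩ := Finset.mem_product.1 hq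
    obtain ⟨hυw, hυv, hυl⟩ := mem_lseeds.1 hq2
    obtain ⟨h1, h2⟩ := dcat_spec hq1 hυw hυl
    rw [hkm] at h1 h2
    rw [hυv] at h2
    exact ⟨h1, h2, dcat_apply_self_one hq1 _, fun t ht h0 htm' => dcat_seed_apply_one_at hq1 hυw hυv ht h0 htm',
      fun h3 => dcat_apply_add_three_zero _ hυw hυl h3⟩
  have Ufacts : ∀ {ω}, ω ∈ wbr (n + 10) → fU ω ∈ wbr N ∧ visits N (fU ω) = visits (n + 10) ω + 1 ∧ fU ω (n + 10) 1 = 0 := by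
    intro ω hω
    have sp := jcat_spec hω htm
    rw [show n + 10 + (2 + 0) = N by omega, visits_zero, add_zero] at sp
    exact ⟨sp.1, sp.2, jcat_apply_self_one hω⟩
  have Jfacts : ∀ {ω}, ω ∈ wbr n → fJ ω ∈ wbr N ∧ visits N (fJ ω) = visits n ω + 2 ∧
      (∀ t, t % 2 = 0 → 0 < t → t < c → fJ ω (n + (2 + t)) 1 ≠ 0) ∧ fJ ω (n + 2) 0 = fJ ω (n + 5) 0 := by
    intro ω hω
    have sp := jcat_spec hω hu
    rw [show n + (2 + c) = N by omega, huv] at sp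
    refine ⟨sp.1, by rw [sp.2], fun t ht h0 ht10 => jcat_seed_apply_one_at hω hu huv ht h0 ht10, ?_⟩
    have hT0 : tailPiece Ten.lw 0 = 0 := (mem_saws_iff.1 (tailPiece_spec hu).1).1
    have hu0 : Ten.lw 0 = 0 := (mem_saws_iff.1 (hpw_subset (archs_subset (wbr_subset hu)))).1
    have e2 : fJ ω (n + 2) = ω n + tailPiece Ten.lw 2 := Zd.concatWalk_apply_add _ _ hT0 2
    have e5 : fJ ω (n + 5) = ω n + tailPiece Ten.lw (2 + 3) := Zd.concatWalk_apply_add _ _ hT0 5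
    rw [e2, e5, Pi.add_apply, Pi.add_apply, tailPiece_apply_zero_of_le _ le_rfl, tailPiece_apply_add_zero hu0,
      Ten.lw_three_zero.1]
    push_cast; ring
  -- images lie in wbr N
  have hUT : (wbr (n + 10)).image fU ⊆ wbr N := by
    intro ζ hζ; obtain ⟨ω, hω, rfl⟩ := Finset.mem_image.1 hζ; exact (Ufacts hω).1
  have hDT : ∀ {k m' : ℕ} (hkm : k + m' = N), ((wbr k) ×ˢ lseeds m').image (fD k) ⊆ wbr N := by
    intro k m' hkm ζ hζ; obtain ⟨q, hq, rfl⟩ := Finset.mem_image.1 hζ; exact (Dfacts hkm hq).1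
  have hJT : (wbr n).image fJ ⊆ wbr N := by
    intro ζ hζ; obtain ⟨ω, hω, rfl⟩ := Finset.mem_image.1 hζ; exact (Jfacts hω).1
  -- injectivity
  have hUinj : Set.InjOn fU ↑(wbr (n + 10)) := by
    intro ω hω ω' hω' h
    have hωs := hpw_subset (archs_subset (wbr_subset (Finset.mem_coe.1 hω)))
    have hω's := hpw_subset (archs_subset (wbr_subset (Finset.mem_coe.1 hω')))
    exact (Zd.concatWalk_injective_pieces (saws_subset _ hωs) (saws_subset _ (tailPiece_spec htm).1)
      (saws_subset _ hω's) (saws_subset _ (tailPiece_spec htm).1) h).1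
  have hJinj : Set.InjOn fJ ↑(wbr n) := by
    intro ω hω ω' hω' h
    have hωs := hpw_subset (archs_subset (wbr_subset (Finset.mem_coe.1 hω)))
    have hω's := hpw_subset (archs_subset (wbr_subset (Finset.mem_coe.1 hω')))
    exact (Zd.concatWalk_injective_pieces (saws_subset _ hωs) (saws_subset _ (tailPiece_spec hu).1)
      (saws_subset _ hω's) (saws_subset _ (tailPiece_spec hu).1) h).1
  have hDinj : ∀ (k m' : ℕ), Set.InjOn (fD k) ↑((wbr k) ×ˢ lseeds m') := fun k m' =>
    dcat_injOn k m' _ (Finset.product_subset_product_right (by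
      intro υ hυ; exact (mem_lseeds.1 hυ).1))
  -- a row criterion for disjointness
  have row_disjoint : ∀ {A B : Finset (ℕ → Site 2)} (t : ℕ), (∀ ζ ∈ A, ζ t 1 = 0) → (∀ ζ ∈ B, ζ t 1 ≠ 0) → Disjoint A B := by
    intro A B t hA hB
    rw [Finset.disjoint_left]
    intro ζ hζA hζB
    exact hB ζ hζB (hA ζ hζA)
  -- on-row / off-row facts of each image at the three test times
  have U_on : ∀ ζ ∈ (wbr (n + 10)).image fU, ζ (n + 10) 1 = 0 := by
    intro ζ hζ; obtain ⟨ω, hω, rfl⟩ := Finset.mem_image.1 hζ; exact (Ufacts hω).2.2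
  have D6_on : ∀ ζ ∈ H₆.image (fD (n + 6)), ζ (n + 6) 1 = 0 := by
    intro ζ hζ; obtain ⟨q, hq, rfl⟩ := Finset.mem_image.1 hζ; exact (Dfacts (m' := a) (by omega) hq).2.2.1
  have D8_on : ∀ ζ ∈ H₈.image (fD (n + 4)), ζ (n + 4) 1 = 0 := by
    intro ζ hζ; obtain ⟨q, hq, rfl⟩ := Finset.mem_image.1 hζ; exact (Dfacts (m' := b) (by omega) hq).2.2.1
  have D6_off : ∀ ζ ∈ H₆.image (fD (n + 6)), ζ (n + 10) 1 ≠ 0 := by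
    intro ζ hζ; obtain ⟨q, hq, rfl⟩ := Finset.mem_image.1 hζ
    have := (Dfacts (m' := a) (by omega) hq).2.2.2.1 4 (by decide) (by norm_num) (by omega)
    rwa [show n + 6 + 4 = n + 10 by omega] at this
  have D8_off10 : ∀ ζ ∈ H₈.image (fD (n + 4)), ζ (n + 10) 1 ≠ 0 := by
    intro ζ hζ; obtain ⟨q, hq, rfl⟩ := Finset.mem_image.1 hζ
    have := (Dfacts (m' := b) (by omega) hq).2.2.2.1 6 (by decide) (by norm_num) (by omega)
    rwa [show n + 4 + 6 = n + 10 by omega] at this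
  have D8_off6 : ∀ ζ ∈ H₈.image (fD (n + 4)), ζ (n + 6) 1 ≠ 0 := by
    intro ζ hζ; obtain ⟨q, hq, rfl⟩ := Finset.mem_image.1 hζ
    have := (Dfacts (m' := b) (by omega) hq).2.2.2.1 2 (by decide) (by norm_num) (by omega)
    rwa [show n + 4 + 2 = n + 6 by omega] at this
  have D10_off10 : ∀ ζ ∈ H₁₀.image (fD (n + 2)), ζ (n + 10) 1 ≠ 0 := by
    intro ζ hζ; obtain ⟨q, hq, rfl⟩ := Finset.mem_image.1 hζ
    have := (Dfacts (m' := c) (by omega) hq).2.2.2.1 8 (by decide) (by norm_num) (by omega)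
    rwa [show n + 2 + 8 = n + 10 by omega] at this
  have D10_off6 : ∀ ζ ∈ H₁₀.image (fD (n + 2)), ζ (n + 6) 1 ≠ 0 := by
    intro ζ hζ; obtain ⟨q, hq, rfl⟩ := Finset.mem_image.1 hζ
    have := (Dfacts (m' := c) (by omega) hq).2.2.2.1 4 (by decide) (by norm_num) (by omega)
    rwa [show n + 2 + 4 = n + 6 by omega] at this
  have D10_off4 : ∀ ζ ∈ H₁₀.image (fD (n + 2)), ζ (n + 4) 1 ≠ 0 := by
    intro ζ hζ; obtain ⟨q, hq, rfl⟩ := Finset.mem_image.1 hζ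
    have := (Dfacts (m' := c) (by omega) hq).2.2.2.1 2 (by decide) (by norm_num) (by omega)
    rwa [show n + 2 + 2 = n + 4 by omega] at this
  have J_off10 : ∀ ζ ∈ (wbr n).image fJ, ζ (n + 10) 1 ≠ 0 := by
    intro ζ hζ; obtain ⟨ω, hω, rfl⟩ := Finset.mem_image.1 hζ
    have := (Jfacts hω).2.2.1 8 (by decide) (by norm_num) (by omega)
    rwa [show n + (2 + 8) = n + 10 by omega] at this
  have J_off6 : ∀ ζ ∈ (wbr n).image fJ, ζ (n + 6) 1 ≠ 0 := by
    intro ζ hζ; obtain ⟨ω, hω, rfl⟩ := Finset.mem_image.1 hζ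
    have := (Jfacts hω).2.2.1 4 (by decide) (by norm_num) (by omega)
    rwa [show n + (2 + 4) = n + 6 by omega] at this
  have J_off4 : ∀ ζ ∈ (wbr n).image fJ, ζ (n + 4) 1 ≠ 0 := by
    intro ζ hζ; obtain ⟨ω, hω, rfl⟩ := Finset.mem_image.1 hζ
    have := (Jfacts hω).2.2.1 2 (by decide) (by norm_num) (by omega)
    rwa [show n + (2 + 2) = n + 4 by omega] at this
  -- the ten pairwise disjointness statements
  have dU6 : Disjoint ((wbr (n + 10)).image fU) (H₆.image (fD (n + 6))) := row_disjoint (n + 10) U_on D6_off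
  have dU8 : Disjoint ((wbr (n + 10)).image fU) (H₈.image (fD (n + 4))) := row_disjoint (n + 10) U_on D8_off10
  have dU10 : Disjoint ((wbr (n + 10)).image fU) (H₁₀.image (fD (n + 2))) := row_disjoint (n + 10) U_on D10_off10
  have dUJ : Disjoint ((wbr (n + 10)).image fU) ((wbr n).image fJ) := row_disjoint (n + 10) U_on J_off10
  have d68 : Disjoint (H₆.image (fD (n + 6))) (H₈.image (fD (n + 4))) := row_disjoint (n + 6) D6_on D8_off6
  have d610 : Disjoint (H₆.image (fD (n + 6))) (H₁₀.image (fD (n + 2))) := row_disjoint (n + 6) D6_on D10_off6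
  have d6J : Disjoint (H₆.image (fD (n + 6))) ((wbr n).image fJ) := row_disjoint (n + 6) D6_on J_off6
  have d810 : Disjoint (H₈.image (fD (n + 4))) (H₁₀.image (fD (n + 2))) := row_disjoint (n + 4) D8_on D10_off4
  have d8J : Disjoint (H₈.image (fD (n + 4))) ((wbr n).image fJ) := row_disjoint (n + 4) D8_on J_off4
  have d10J : Disjoint (H₁₀.image (fD (n + 2))) ((wbr n).image fJ) := by
    rw [Finset.disjoint_left]
    intro ζ hζD hζJ
    obtain ⟨q, hq, rfl⟩ := Finset.mem_image.1 hζD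
    obtain ⟨ω, hω, he⟩ := Finset.mem_image.1 hζJ
    have h1 := (Dfacts (m' := c) (by omega) hq).2.2.2.2 (by omega)
    have h2 := (Jfacts hω).2.2.2
    rw [he] at h2
    rw [show n + 2 + 3 = n + 5 by omega] at h1
    -- `h1 : X_{n+2} + 1 ≤ X_{n+5}`, `h2 : X_{n+2} = X_{n+5}`
    omega
  -- the five sums
  have hsumU : ∑ ζ ∈ (wbr (n + 10)).image fU, y ^ visits N ζ = y * WB (n + 10) y := by
    rw [Finset.sum_image hUinj, WB, Finset.mul_sum]
    refine Finset.sum_congr rfl fun ω hω => ?_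
    rw [(Ufacts hω).2.1, pow_succ, mul_comm]
  have hsumD : ∀ {k m' : ℕ} (hkm : k + m' = N),
      ∑ ζ ∈ ((wbr k) ×ˢ lseeds m').image (fD k), y ^ visits N ζ = (lsN m' : ℝ) * y * WB k y := by
    intro k m' hkm
    rw [Finset.sum_image (hDinj k m'), Finset.sum_product, WB, Finset.mul_sum]
    refine Finset.sum_congr rfl fun ω hω => ?_
    have hterm : ∀ υ ∈ lseeds m', y ^ visits N (fD k (ω, υ)) = y * y ^ visits k ω := by
      intro υ hυ
      rw [(Dfacts hkm (Finset.mem_product.2 ⟨hω, hυ⟩)).2.1, pow_succ, mul_comm]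
    rw [Finset.sum_congr rfl hterm, Finset.sum_const, nsmul_eq_mul, lsN]
    ring
  have hsumJ : ∑ ζ ∈ (wbr n).image fJ, y ^ visits N ζ = y ^ 2 * WB n y := by
    rw [Finset.sum_image hJinj, WB, Finset.mul_sum]
    refine Finset.sum_congr rfl fun ω hω => ?_
    rw [(Jfacts hω).2.1, pow_add, mul_comm]
  have hsum6 := hsumD (k := n + 6) (m' := a) (by omega)
  have hsum8 := hsumD (k := n + 4) (m' := b) (by omega)
  have hsum10 := hsumD (k := n + 2) (m' := c) (by omega)
  -- assemble
  set SU := (wbr (n + 10)).image fU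
  set S6 := H₆.image (fD (n + 6))
  set S8 := H₈.image (fD (n + 4))
  set S10 := H₁₀.image (fD (n + 2))
  set SJ := (wbr n).image fJ
  have dA : Disjoint SU (S6 ∪ (S8 ∪ (S10 ∪ SJ))) :=
    Finset.disjoint_union_right.2 ⟨dU6, Finset.disjoint_union_right.2 ⟨dU8, Finset.disjoint_union_right.2 ⟨dU10, dUJ⟩⟩⟩
  have dB : Disjoint S6 (S8 ∪ (S10 ∪ SJ)) :=
    Finset.disjoint_union_right.2 ⟨d68, Finset.disjoint_union_right.2 ⟨d610, d6J⟩⟩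
  have dC : Disjoint S8 (S10 ∪ SJ) := Finset.disjoint_union_right.2 ⟨d810, d8J⟩
  have hsub : SU ∪ (S6 ∪ (S8 ∪ (S10 ∪ SJ))) ⊆ wbr N :=
    Finset.union_subset hUT (Finset.union_subset (hDT (by omega))
      (Finset.union_subset (hDT (by omega)) (Finset.union_subset (hDT (by omega)) hJT)))
  calc y * WB (n + 10) y + (lsN a : ℝ) * y * WB (n + 6) y + (lsN b : ℝ) * y * WB (n + 4) y + (lsN c : ℝ) * y * WB (n + 2) y +
        y ^ 2 * WB n y
      = ∑ ζ ∈ SU ∪ (S6 ∪ (S8 ∪ (S10 ∪ SJ))), y ^ visits N ζ := by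
        rw [Finset.sum_union dA, Finset.sum_union dB, Finset.sum_union dC, Finset.sum_union d10J, hsumU, hsum6, hsum8,
          hsum10, hsumJ]
        ring
    _ ≤ ∑ ζ ∈ wbr N, y ^ visits N ζ := Finset.sum_le_sum_of_subset_of_nonneg hsub fun _ _ _ => pow_nonneg hy _
    _ = WB (n + 12) y := by rw [WB]

/-! ### §5  Subsolutions of the four-seed recursion are lower bounds for `β(y)²` -/

/-- ★ **Every positive subsolution of the four-seed recursion is a lower bound**: if `x > 0` and
`x⁶ ≤ y x⁵ + ℓ₆ y x³ + ℓ₈ y x² + ℓ₁₀ y x + y²` then `x ≤ β(y)²` (the recursion on even lengths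
`E_{j+6} ≥ y E_{j+5} + ℓ₆ y E_{j+3} + ℓ₈ y E_{j+2} + ℓ₁₀ y E_{j+1} + y² E_j`, `E_j = B^w_{2j}(y)`, propagates `E_j ≥ c x^j` from the first six
values; `E_j ≤ (β²/y)(β²)^j` caps). [cite: MadrasSlade1993, §1.2, (1.2.15)–(1.2.17)] [cite: HammersleyTorrieWhittington1982, §2] -/
theorem le_sq_wallRate_of_four_seed_subsolution (hy : 0 < y) {x : ℝ} (hx : 0 < x)
    (hsub : x ^ 6 ≤ y * x ^ 5 + (lsN 6 : ℝ) * y * x ^ 3 + (lsN 8 : ℝ) * y * x ^ 2 + (lsN 10 : ℝ) * y * x + y ^ 2) :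
    x ≤ wallRate y ^ 2 := by
  set l₆ : ℝ := (lsN 6 : ℝ) with hl6
  set l₈ : ℝ := (lsN 8 : ℝ) with hl8
  set l₁₀ : ℝ := (lsN 10 : ℝ) with hl10
  have hl60 : 0 ≤ l₆ := Nat.cast_nonneg _
  have hl80 : 0 ≤ l₈ := Nat.cast_nonneg _
  have hl100 : 0 ≤ l₁₀ := Nat.cast_nonneg _
  set E : ℕ → ℝ := fun j => WB (2 * j) y with hE
  have hEpos : ∀ j, 0 < E j := fun j => WB_pos hy j
  have hrec : ∀ j, y * E (j + 5) + l₆ * y * E (j + 3) + l₈ * y * E (j + 2) + l₁₀ * y * E (j + 1) + y ^ 2 * E j ≤ E (j + 6) := by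
    intro j
    have := WB_four_seed_rec (2 * j) hy.le
    simp only [hE]
    rw [show 2 * (j + 5) = 2 * j + 10 by ring, show 2 * (j + 3) = 2 * j + 6 by ring, show 2 * (j + 2) = 2 * j + 4 by ring,
      show 2 * (j + 1) = 2 * j + 2 by ring, show 2 * (j + 6) = 2 * j + 12 by ring]
    exact this
  have hne : (Finset.range 6).Nonempty := ⟨0, by simp⟩
  set c : ℝ := (Finset.range 6).inf' hne (fun j => E j / x ^ j) with hc
  have hcpos : 0 < c := by
    rw [hc, Finset.lt_inf'_iff]
    exact fun j _ => div_pos (hEpos j) (pow_pos hx j)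
  have hbase : ∀ j < 6, c * x ^ j ≤ E j := by
    intro j hj
    have hcj : c ≤ E j / x ^ j := Finset.inf'_le _ (Finset.mem_range.2 hj)
    exact (le_div_iff₀ (pow_pos hx j)).1 hcj
  have hall : ∀ j, c * x ^ j ≤ E j := by
    intro j
    induction j using Nat.strong_induction_on with
    | _ j ih =>
      rcases lt_or_ge j 6 with hj | hj
      · exact hbase j hj
      · obtain ⟨i, rfl⟩ : ∃ i, j = i + 6 := ⟨j - 6, by omega⟩
        have h5 := ih (i + 5) (by omega)
        have h3 := ih (i + 3) (by omega)
        have h2 := ih (i + 2) (by omega)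
        have h1 := ih (i + 1) (by omega)
        have h0 := ih i (by omega)
        calc c * x ^ (i + 6) = c * x ^ i * x ^ 6 := by ring
          _ ≤ c * x ^ i * (y * x ^ 5 + l₆ * y * x ^ 3 + l₈ * y * x ^ 2 + l₁₀ * y * x + y ^ 2) :=
              mul_le_mul_of_nonneg_left hsub (mul_nonneg hcpos.le (pow_nonneg hx.le _))
          _ = y * (c * x ^ (i + 5)) + l₆ * y * (c * x ^ (i + 3)) + l₈ * y * (c * x ^ (i + 2)) + l₁₀ * y * (c * x ^ (i + 1)) +
                y ^ 2 * (c * x ^ i) := by ring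
          _ ≤ y * E (i + 5) + l₆ * y * E (i + 3) + l₈ * y * E (i + 2) + l₁₀ * y * E (i + 1) + y ^ 2 * E i := by
              have a5 := mul_le_mul_of_nonneg_left h5 hy.le
              have a3 := mul_le_mul_of_nonneg_left h3 (mul_nonneg hl60 hy.le)
              have a2 := mul_le_mul_of_nonneg_left h2 (mul_nonneg hl80 hy.le)
              have a1 := mul_le_mul_of_nonneg_left h1 (mul_nonneg hl100 hy.le)
              have a0 := mul_le_mul_of_nonneg_left h0 (pow_nonneg hy.le 2)
              linarith
          _ ≤ E (i + 6) := hrec i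
  set B : ℝ := wallRate y ^ 2 with hB
  have hβ := wallRate_pos y
  have hBpos : 0 < B := pow_pos hβ 2
  have hup : ∀ j, E j ≤ B / y * B ^ j := by
    intro j
    have := WB_le_pow hy (2 * j)
    simp only [hE]
    rw [hB, ← pow_mul]
    exact this
  by_contra hlt
  push Not at hlt
  have hratio : 1 < x / B := (one_lt_div hBpos).2 hlt
  have hbd : ∀ j, (x / B) ^ j ≤ B / (y * c) := by
    intro j
    have h1 : c * x ^ j ≤ B / y * B ^ j := (hall j).trans (hup j)
    have h1' : c * x ^ j * y ≤ B * B ^ j := by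
      rw [div_mul_eq_mul_div, le_div_iff₀ hy] at h1
      exact h1
    rw [div_pow, div_le_div_iff₀ (pow_pos hBpos j) (mul_pos hy hcpos)]
    linarith
  obtain ⟨j, hj⟩ := ((tendsto_pow_atTop_atTop_of_one_lt hratio).eventually_gt_atTop (B / (y * c))).exists
  exact absurd (hbd j) (not_le.2 hj)

/-- ★★ **THE FOUR-SEED FREE-ENERGY INEQUALITY `y β¹⁰ + ℓ₆ y β⁶ + ℓ₈ y β⁴ + ℓ₁₀ y β² + y² ≤ β¹²`** (every `y > 0`): `β(y)²` is not a
strict subsolution (continuity). [cite: JansevanRensburg2000, §3.3.2, Lemma 3.20] [cite: HammersleyTorrieWhittington1982, §2] [cite: MadrasSlade1993, §1.2, (1.2.17)] -/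
theorem four_seed_le_wallRate_pow_twelve (hy : 0 < y) :
    y * wallRate y ^ 10 + (lsN 6 : ℝ) * y * wallRate y ^ 6 + (lsN 8 : ℝ) * y * wallRate y ^ 4 + (lsN 10 : ℝ) * y * wallRate y ^ 2 +
        y ^ 2 ≤ wallRate y ^ 12 := by
  set B : ℝ := wallRate y ^ 2 with hB
  have hBpos : 0 < B := pow_pos (wallRate_pos y) 2
  have e10 : wallRate y ^ 10 = B ^ 5 := by rw [hB, ← pow_mul]
  have e6 : wallRate y ^ 6 = B ^ 3 := by rw [hB, ← pow_mul]
  have e4 : wallRate y ^ 4 = B ^ 2 := by rw [hB, ← pow_mul]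
  have e12 : wallRate y ^ 12 = B ^ 6 := by rw [hB, ← pow_mul]
  rw [e10, e6, e4, e12]
  by_contra hlt
  push Not at hlt
  set g : ℝ → ℝ := fun x => y * x ^ 5 + (lsN 6 : ℝ) * y * x ^ 3 + (lsN 8 : ℝ) * y * x ^ 2 + (lsN 10 : ℝ) * y * x + y ^ 2 - x ^ 6
    with hg
  have hgB : 0 < g B := by simp only [hg]; linarith
  have hcont : Continuous g := by simp only [hg]; fun_prop
  have hnhds : {x | 0 < g x} ∈ 𝓝 B := hcont.continuousAt.preimage_mem_nhds (Ioi_mem_nhds hgB)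
  have hev : ∀ᶠ x in 𝓝[Set.Ioi B] B, 0 < g x := eventually_nhdsWithin_of_eventually_nhds hnhds
  obtain ⟨x, hxg, hxB⟩ := (hev.and self_mem_nhdsWithin).exists
  have hxB' : B < x := hxB
  have hx : 0 < x := hBpos.trans hxB'
  have hsub : x ^ 6 ≤ y * x ^ 5 + (lsN 6 : ℝ) * y * x ^ 3 + (lsN 8 : ℝ) * y * x ^ 2 + (lsN 10 : ℝ) * y * x + y ^ 2 := by
    simp only [hg] at hxg; linarith
  exact absurd (le_sq_wallRate_of_four_seed_subsolution hy hx hsub) (not_le.2 hxB')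

/-- ★★ **`β(y)² ≥ y + y/β(y)⁴ + y/β(y)⁶ + 3y/β(y)⁸ + y²/β(y)¹⁰`** (every `y > 0`; `ℓ₆, ℓ₈ ≥ 1`, `ℓ₁₀ ≥ 3`).
[cite: JansevanRensburg2000, §3.3.2, Lemma 3.20] [cite: HammersleyTorrieWhittington1982, §2] -/
theorem add_four_seed_div_le_sq_wallRate (hy : 0 < y) :
    y + y / wallRate y ^ 4 + y / wallRate y ^ 6 + 3 * y / wallRate y ^ 8 + y ^ 2 / wallRate y ^ 10 ≤ wallRate y ^ 2 := by
  have hβ := wallRate_pos y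
  have h10 : 0 < wallRate y ^ 10 := pow_pos hβ 10
  have key := four_seed_le_wallRate_pow_twelve hy
  have h6 : (1 : ℝ) ≤ lsN 6 := by exact_mod_cast one_le_lsN_six
  have h8 : (1 : ℝ) ≤ lsN 8 := by exact_mod_cast one_le_lsN_eight
  have h10' : (3 : ℝ) ≤ lsN 10 := by exact_mod_cast three_le_lsN_ten
  have key' : y * wallRate y ^ 10 + y * wallRate y ^ 6 + y * wallRate y ^ 4 + 3 * y * wallRate y ^ 2 + y ^ 2 ≤ wallRate y ^ 12 := by
    have a : y * wallRate y ^ 6 ≤ (lsN 6 : ℝ) * y * wallRate y ^ 6 := by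
      rw [mul_assoc]; exact le_mul_of_one_le_left (by positivity) h6
    have b : y * wallRate y ^ 4 ≤ (lsN 8 : ℝ) * y * wallRate y ^ 4 := by
      rw [mul_assoc]; exact le_mul_of_one_le_left (by positivity) h8
    have c : 3 * y * wallRate y ^ 2 ≤ (lsN 10 : ℝ) * y * wallRate y ^ 2 := by
      rw [mul_assoc, mul_assoc]; exact mul_le_mul_of_nonneg_right h10' (by positivity)
    linarith
  have e : y + y / wallRate y ^ 4 + y / wallRate y ^ 6 + 3 * y / wallRate y ^ 8 + y ^ 2 / wallRate y ^ 10 =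
      (y * wallRate y ^ 10 + y * wallRate y ^ 6 + y * wallRate y ^ 4 + 3 * y * wallRate y ^ 2 + y ^ 2) / wallRate y ^ 10 := by
    field_simp
  rw [e, div_le_iff₀ h10, show wallRate y ^ 2 * wallRate y ^ 10 = wallRate y ^ 12 by ring]
  exact key'

/-! ### §6  THE FOURTH-ORDER LOWER WINDOW -/

/-- Bernoulli from below for the inverse powers: `(Y − k p)(Y + p)^k ≤ Y^{k+1}` for `k = 2, 3, 4, 5` (`Y, p ≥ 0`).
[cite: MadrasSlade1993, §1.2, (1.2.17)] -/
theorem bernoulli_inv_aux {Y p : ℝ} (hY : 0 ≤ Y) (hp : 0 ≤ p) :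
    (Y - 2 * p) * (Y + p) ^ 2 ≤ Y ^ 3 ∧ (Y - 3 * p) * (Y + p) ^ 3 ≤ Y ^ 4 ∧ (Y - 4 * p) * (Y + p) ^ 4 ≤ Y ^ 5 ∧
      (Y - 5 * p) * (Y + p) ^ 5 ≤ Y ^ 6 := by
  have h2 : 0 ≤ p ^ 2 := sq_nonneg p
  have hYp : 0 ≤ Y * p := mul_nonneg hY hp
  refine ⟨?_, ?_, ?_, ?_⟩
  · nlinarith [mul_nonneg hY h2, mul_nonneg hp h2]
  · nlinarith [mul_nonneg (mul_nonneg hY hY) h2, mul_nonneg hYp h2, mul_nonneg h2 h2]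
  · nlinarith [mul_nonneg (pow_nonneg hY 3) h2, mul_nonneg (mul_nonneg hY hY) (mul_nonneg hp h2), mul_nonneg hY (mul_nonneg h2 h2),
      mul_nonneg hp (mul_nonneg h2 h2)]
  · nlinarith [mul_nonneg (pow_nonneg hY 4) h2, mul_nonneg (pow_nonneg hY 3) (mul_nonneg hp h2),
      mul_nonneg (mul_nonneg hY hY) (mul_nonneg h2 h2), mul_nonneg hY (mul_nonneg hp (mul_nonneg h2 h2)),
      mul_nonneg h2 (mul_nonneg h2 h2)]

/-- ★★★ **THE FOURTH-ORDER LOWER WINDOW UNDER A SECOND-ORDER UPPER WINDOW**: if `β(y)² ≤ y + 1/y + C/y²` (`C ≥ 0`, `y > 0`), then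
`β(y)² ≥ y + 1/y + 1/y² + 2/y³ − (3 + 2C)/y⁴ − (17 + 3C)/y⁵ − 17C/y⁶` (insert the upper window into the four denominators of
`add_four_seed_div_le_sq_wallRate` and use Bernoulli). [cite: JansevanRensburg2000, §3.3.2, Lemma 3.20] [cite: HammersleyTorrieWhittington1982, §2] [cite: BeatonBousquetMelouDeGierDuminilCopinGuttmann2014, §3.1, Proposition 5 (arXiv v5 p. 9)] -/
theorem fourth_window_lower (hy : 0 < y) {C : ℝ} (hC : 0 ≤ C) (hup : wallRate y ^ 2 ≤ y + 1 / y + C / y ^ 2) :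
    y + 1 / y + 1 / y ^ 2 + 2 / y ^ 3 - (3 + 2 * C) / y ^ 4 - (17 + 3 * C) / y ^ 5 - 17 * C / y ^ 6 ≤ wallRate y ^ 2 := by
  have hβ := wallRate_pos y
  have key := add_four_seed_div_le_sq_wallRate hy
  rw [show wallRate y ^ 4 = (wallRate y ^ 2) ^ 2 by ring, show wallRate y ^ 6 = (wallRate y ^ 2) ^ 3 by ring,
    show wallRate y ^ 8 = (wallRate y ^ 2) ^ 4 by ring, show wallRate y ^ 10 = (wallRate y ^ 2) ^ 5 by ring] at key
  set B : ℝ := wallRate y ^ 2 with hB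
  have hBpos : 0 < B := pow_pos hβ 2
  -- the upper window as `B ≤ D / y²` with `D = y³ + y + C = Y + p`
  set Y : ℝ := y ^ 3 with hYdef
  set p : ℝ := y + C with hpdef
  set D : ℝ := Y + p with hD
  have hY : 0 < Y := pow_pos hy 3
  have hp : 0 ≤ p := by positivity
  have hDpos : 0 < D := by positivity
  have hBU : B ≤ D / y ^ 2 := by
    have e : D / y ^ 2 = y + 1 / y + C / y ^ 2 := by
      rw [hD, hYdef, hpdef]; field_simp; ring
    rw [e]; exact hup
  have hBk : ∀ k : ℕ, B ^ k * y ^ (2 * k) ≤ D ^ k := fun k => by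
    have h := pow_le_pow_left₀ hBpos.le hBU k
    rw [div_pow, le_div_iff₀ (pow_pos (pow_pos hy 2) k), ← pow_mul y 2 k] at h
    exact h
  obtain ⟨b2, b3, b4, b5⟩ := bernoulli_inv_aux hY.le hp
  -- monotonicity in `B ≤ D/y²`
  have m2 : y ^ 5 / D ^ 2 ≤ y / B ^ 2 := by
    rw [div_le_div_iff₀ (pow_pos hDpos 2) (pow_pos hBpos 2)]
    have h := mul_le_mul_of_nonneg_left (hBk 2) hy.le
    calc y ^ 5 * B ^ 2 = y * (B ^ 2 * y ^ (2 * 2)) := by ring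
      _ ≤ y * D ^ 2 := h
  have m3 : y ^ 7 / D ^ 3 ≤ y / B ^ 3 := by
    rw [div_le_div_iff₀ (pow_pos hDpos 3) (pow_pos hBpos 3)]
    have h := mul_le_mul_of_nonneg_left (hBk 3) hy.le
    calc y ^ 7 * B ^ 3 = y * (B ^ 3 * y ^ (2 * 3)) := by ring
      _ ≤ y * D ^ 3 := h
  have m4 : y ^ 9 / D ^ 4 ≤ y / B ^ 4 := by
    rw [div_le_div_iff₀ (pow_pos hDpos 4) (pow_pos hBpos 4)]
    have h := mul_le_mul_of_nonneg_left (hBk 4) hy.le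
    calc y ^ 9 * B ^ 4 = y * (B ^ 4 * y ^ (2 * 4)) := by ring
      _ ≤ y * D ^ 4 := h
  have m5 : y ^ 12 / D ^ 5 ≤ y ^ 2 / B ^ 5 := by
    rw [div_le_div_iff₀ (pow_pos hDpos 5) (pow_pos hBpos 5)]
    have h := mul_le_mul_of_nonneg_left (hBk 5) (pow_pos hy 2).le
    calc y ^ 12 * B ^ 5 = y ^ 2 * (B ^ 5 * y ^ (2 * 5)) := by ring
      _ ≤ y ^ 2 * D ^ 5 := h
  -- Bernoulli
  have l2 : (Y - 2 * p) / y ^ 4 ≤ y ^ 5 / D ^ 2 := by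
    rw [div_le_div_iff₀ (pow_pos hy 4) (pow_pos hDpos 2)]
    calc (Y - 2 * p) * D ^ 2 = (Y - 2 * p) * (Y + p) ^ 2 := by rw [hD]
      _ ≤ Y ^ 3 := b2
      _ = y ^ 5 * y ^ 4 := by rw [hYdef]; ring
  have l3 : (Y - 3 * p) / y ^ 5 ≤ y ^ 7 / D ^ 3 := by
    rw [div_le_div_iff₀ (pow_pos hy 5) (pow_pos hDpos 3)]
    calc (Y - 3 * p) * D ^ 3 = (Y - 3 * p) * (Y + p) ^ 3 := by rw [hD]
      _ ≤ Y ^ 4 := b3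
      _ = y ^ 7 * y ^ 5 := by rw [hYdef]; ring
  have l4 : (Y - 4 * p) / y ^ 6 ≤ y ^ 9 / D ^ 4 := by
    rw [div_le_div_iff₀ (pow_pos hy 6) (pow_pos hDpos 4)]
    calc (Y - 4 * p) * D ^ 4 = (Y - 4 * p) * (Y + p) ^ 4 := by rw [hD]
      _ ≤ Y ^ 5 := b4
      _ = y ^ 9 * y ^ 6 := by rw [hYdef]; ring
  have l5 : (Y - 5 * p) / y ^ 6 ≤ y ^ 12 / D ^ 5 := by
    rw [div_le_div_iff₀ (pow_pos hy 6) (pow_pos hDpos 5)]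
    calc (Y - 5 * p) * D ^ 5 = (Y - 5 * p) * (Y + p) ^ 5 := by rw [hD]
      _ ≤ Y ^ 6 := b5
      _ = y ^ 12 * y ^ 6 := by rw [hYdef]; ring
  have e : y + 1 / y + 1 / y ^ 2 + 2 / y ^ 3 - (3 + 2 * C) / y ^ 4 - (17 + 3 * C) / y ^ 5 - 17 * C / y ^ 6 =
      y + (Y - 2 * p) / y ^ 4 + (Y - 3 * p) / y ^ 5 + 3 * ((Y - 4 * p) / y ^ 6) + (Y - 5 * p) / y ^ 6 := by
    rw [hYdef, hpdef]; field_simp; ring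
  have e3 : 3 * y / B ^ 4 = 3 * (y / B ^ 4) := by ring
  rw [e3] at key
  rw [e]
  linarith

/-- ★★★ **THE FOURTH-ORDER LOWER WINDOW** (with the companion's `β(y)² ≤ y + 1/y + 8748/y²`, every `y ≥ 1`):
`y + 1/y + 1/y² + 2/y³ − 192476/y⁴ ≤ β(y)²`. [cite: JansevanRensburg2000, §3.3.2, Lemma 3.20] [cite: HammersleyTorrieWhittington1982, §2] [cite: BeatonBousquetMelouDeGierDuminilCopinGuttmann2014, §3.1, Proposition 5 (arXiv v5 p. 9); p. 10 (first-order remark)] -/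
theorem fourth_lower_sharp (hy : 1 ≤ y) : y + 1 / y + 1 / y ^ 2 + 2 / y ^ 3 - 192476 / y ^ 4 ≤ wallRate y ^ 2 := by
  have hy0 : 0 < y := by linarith
  have h := fourth_window_lower hy0 (C := 8748) (by norm_num) (wallRate_sq_le_sharp hy)
  have h5 : (17 + 3 * 8748 : ℝ) / y ^ 5 ≤ (17 + 3 * 8748) / y ^ 4 :=
    div_le_div_of_nonneg_left (by norm_num) (pow_pos hy0 4) (pow_le_pow_right₀ hy (by norm_num))
  have h6 : (17 * 8748 : ℝ) / y ^ 6 ≤ (17 * 8748) / y ^ 4 :=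
    div_le_div_of_nonneg_left (by norm_num) (pow_pos hy0 4) (pow_le_pow_right₀ hy (by norm_num))
  have e : (192476 : ℝ) / y ^ 4 = (3 + 2 * 8748) / y ^ 4 + (17 + 3 * 8748) / y ^ 4 + 17 * 8748 / y ^ 4 := by
    rw [← add_div, ← add_div]; norm_num
  rw [e]
  linarith

/-- ★★★ **`2 − 192476/y ≤ y³ (β(y)² − y − 1/y − 1/y²)`** (every `y ≥ 1`): the fourth coefficient of the adsorbed-phase expansion is
at least `2`. [cite: JansevanRensburg2000, §3.3.2, Lemma 3.20] [cite: BeatonBousquetMelouDeGierDuminilCopinGuttmann2014, §3.1 (arXiv v5 p. 10: first-order remark)] -/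
theorem two_sub_div_le_cube_mul (hy : 1 ≤ y) :
    2 - 192476 / y ≤ y ^ 3 * (wallRate y ^ 2 - y - 1 / y - 1 / y ^ 2) := by
  have hy0 : 0 < y := by linarith
  have h := fourth_lower_sharp hy
  have e : y ^ 3 * (wallRate y ^ 2 - y - 1 / y - 1 / y ^ 2) =
      y ^ 3 * (wallRate y ^ 2 - (y + 1 / y + 1 / y ^ 2 + 2 / y ^ 3 - 192476 / y ^ 4)) + (2 - 192476 / y) := by
    field_simp
    ring
  rw [e]
  have : 0 ≤ y ^ 3 * (wallRate y ^ 2 - (y + 1 / y + 1 / y ^ 2 + 2 / y ^ 3 - 192476 / y ^ 4)) :=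
    mul_nonneg (pow_nonneg hy0.le 3) (by linarith)
  linarith

/-- ★★★ **`liminf_{y→∞} y³ (β(y)² − y − 1/y − 1/y²) ≥ 2`** in the elementary form: every `a < 2` is eventually below
`y³ (β(y)² − y − 1/y − 1/y²)`. [cite: JansevanRensburg2000, §3.3.2, Lemma 3.20] [cite: BeatonBousquetMelouDeGierDuminilCopinGuttmann2014, §3.1 (arXiv v5 p. 10: first-order remark)] -/
theorem eventually_le_cube_mul_wallRate_sq_sub {a : ℝ} (ha : a < 2) :
    ∀ᶠ y : ℝ in atTop, a ≤ y ^ 3 * (wallRate y ^ 2 - y - 1 / y - 1 / y ^ 2) := by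
  have h1 : ∀ᶠ y : ℝ in atTop, 1 ≤ y := eventually_ge_atTop 1
  have h2 : ∀ᶠ y : ℝ in atTop, 192476 / (2 - a) ≤ y := eventually_ge_atTop _
  filter_upwards [h1, h2] with y hy hy2
  have hy0 : 0 < y := by linarith
  have h := two_sub_div_le_cube_mul hy
  have h3 : 192476 / y ≤ 2 - a := by
    rw [div_le_iff₀ hy0]
    have := (div_le_iff₀ (by linarith : (0:ℝ) < 2 - a)).1 hy2
    linarith
  linarith

/-! ### §7  The same for BBdGDCG's `μ(y)` -/

/-- ★★★ **`μ(y)² ≥ y + 1/y + 1/y² + 2/y³ − 192476/y⁴`** for BBdGDCG's surface growth rate `μ(y) = HV.surfaceMu y` (`y ≥ 1`; transfer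
through `HV.wallRate_eq_surfaceMu`). [cite: BeatonBousquetMelouDeGierDuminilCopinGuttmann2014, §3.1, Proposition 5 (arXiv v5 p. 9); p. 10 (first-order remark)] [cite: JansevanRensburg2000, §3.3.2, Lemma 3.20] -/
theorem surfaceMu_sq_fourth_lower (hy : 1 ≤ y) : y + 1 / y + 1 / y ^ 2 + 2 / y ^ 3 - 192476 / y ^ 4 ≤ HV.surfaceMu y ^ 2 := by
  rw [← HV.wallRate_eq_surfaceMu (by linarith)]
  exact fourth_lower_sharp hy

/-- ★★★ **`2 − 192476/y ≤ y³ (μ(y)² − y − 1/y − 1/y²)`** (`y ≥ 1`). [cite: BeatonBousquetMelouDeGierDuminilCopinGuttmann2014, §3.1, Proposition 5 (arXiv v5 p. 9); p. 10 (first-order remark)] [cite: JansevanRensburg2000, §3.3.2, Lemma 3.20] -/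
theorem two_sub_div_le_cube_mul_surfaceMu (hy : 1 ≤ y) :
    2 - 192476 / y ≤ y ^ 3 * (HV.surfaceMu y ^ 2 - y - 1 / y - 1 / y ^ 2) := by
  rw [← HV.wallRate_eq_surfaceMu (by linarith)]
  exact two_sub_div_le_cube_mul hy

/-- ★★★ **`liminf_{y→∞} y³ (μ(y)² − y − 1/y − 1/y²) ≥ 2`** (elementary form). [cite: BeatonBousquetMelouDeGierDuminilCopinGuttmann2014, §3.1, Proposition 5 (arXiv v5 p. 9); p. 10 (first-order remark)] [cite: JansevanRensburg2000, §3.3.2, Lemma 3.20] -/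
theorem eventually_le_cube_mul_surfaceMu_sq_sub {a : ℝ} (ha : a < 2) :
    ∀ᶠ y : ℝ in atTop, a ≤ y ^ 3 * (HV.surfaceMu y ^ 2 - y - 1 / y - 1 / y ^ 2) := by
  filter_upwards [eventually_le_cube_mul_wallRate_sq_sub ha, eventually_gt_atTop 0] with y h hy0
  rwa [HV.wallRate_eq_surfaceMu hy0] at h

end Literature.Probability.RandomPlanarGeometry.SAW.HexBW.Wall
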